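import Summits.AtomisticToContinuum.Crystallization.Theses.HcpDefectCounting

/-!
# Line `birth` — birth-certificate skeleton (BC3) for the crux `HcpDefectCoercivity`
(stmt-AtomisticToContinuum-14476, route `HcpDefectCounting`, crux rank 2; skeleton-register one-shot,
planner-skel-stmt-AtomisticToContinuum-14476-0, 2026-08-17)

THE ∀ (a h : ℝ) (ha : a ≠ 0) (hh : h ≠ 0), 47 / 50 ≤ a → a ≤ 1 → 39 / 50 * a ≤ h → h ≤ 17 / 20 * a → (∀ (N : ℕ) (x : Fin N → EuclideanSpace ℝ (Fin 3)), Function.Injective x → (N : ℝ) * (Literature.MathematicalPhysics.StatisticalMechanics.hcpPeriodicConfiguration ha hh).energyPerParticle Literature.MathematicalPhysics.StatisticalMechanics.lennardJones ≤ Literature.MathematicalPhysics.StatisticalMechanics.interactionEnergy Literature.MathematicalPhysics.StatisticalMechanics.lennardJones x) → ∀ δ θ : ℝ, 0 < δ → 0 < θ → ∃ κ : ℝ, 0 < κ ∧ ∀ (N : ℕ) (x : Fin N → EuclideanSpace ℝ (Fin 3)), (∀ i j : Fin N, i ≠ j → δ ≤ dist (x i) (x j)) → let Good : ℝ → ℝ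 → Fin N → Prop := fun ρ η i => ∃ A : EuclideanSpace ℝ (Fin 3) →ₗᵢ[ℝ] EuclideanSpace ℝ (Fin 3), (∀ p ∈ (Literature.MathematicalPhysics.StatisticalMechanics.hcpPeriodicConfiguration ha hh).points, ‖p‖ ≤ ρ → ∃ j : Fin N, dist (x j) (x i + A p) ≤ η) ∧ (∀ j : Fin N, dist (x j) (x i) ≤ ρ → ∃ p ∈ (Literature.MathematicalPhysics.StatisticalMechanics.hcpPeriodicConfiguration ha hh).points, dist (x j) (x i + A p) ≤ η); (N : ℝ) * (Literature.MathematicalPhysics.StatisticalMechanics.hcpPeriodicConfiguration ha hh).energyPerParticle Literature.MathematicalPhysics.StatisticalMechanics.lennardJones + κ * (Nat.card {i : Fin N // ¬ Good 4 θ i} : ℝ) ≤ Literature.MathematicalPhysics.StatisticalMechanics.interactionEnergy Literature.MathematicalPhysics.StatisticalMechanics.lennardJones x (defect-counting coercivity at radius 4 around relaxed hcp, CONDITIONAL on the finite bulk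
floor): for every `(a, h)` in the box `47/50 ≤ a ≤ 1`, `39/50·a ≤ h ≤ 17/20·a` such that
`N · e_LJ(hcp a h) ≤ 𝓔_LJ(x)` for every finite injective `x` (so only the LJ-optimal relaxed hcp is
concerned), and every `δ, θ > 0`, there is `κ > 0` with
`N · e_LJ(hcp a h) + κ · #{i : ¬Good_hcp(4, θ, i)} ≤ 𝓔_LJ(x)` for every `δ`-separated `x : Fin N → ℝ³`,
where `Good_S(ρ, η, i)` is the two-way `η`-matching, after a linear isometry `A`, of the particles in
`B_ρ(x_i)` with `x_i + A(S ∩ B_ρ)` (template `S` = the hcp point set; `0 ∈ S`, hcp vertex-transitive).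

THE LINE = the route header's own foreseen two-layer plan for this node ("HcpDefectCoercivity ⇐
BarlowTier → StackingTier → HcpDefectCoercivity"), typed so that the glue is pure counting, with the
Barlow tier itself cut at its natural scale into an ENERGETIC first-shell inequality and a
POTENTIAL-FREE chart lemma.  Write `Good_S(ρ, η, i)` for the matching predicate with an arbitrary
template `S ⊆ ℝ³` (the `let GoodT := …` of the stubs; for `S = (hcp a h).points` it is literally the
crux's `Good`), `Barlow(a,h,s) = barlowStacking a h s` for a Hägg sequence `s` (every site of every
Barlow stacking is the origin of some `Barlow(a,h,s')`, `s'` a shift of `s`, so origin-based charts over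
ALL `s` see every close-packed local environment), and `fcc(a,h) = (fccPeriodicConfiguration ha hh).points`.
Three defect classes, three stubs:

* `stub_shellTier` (ENERGY, first shell; the hardest) — particles whose first coordination shell
  (radius `6/5`, which isolates the 12-shell on the whole box: shell radii `a`, `√(a²/3+h²) ≤ 1.027a ≤ 1.03`,
  next sites `≥ 1.39a ≥ 1.30`) is `θ`-far from BOTH close-packed shells — the anticuboctahedral one
  (`hcp(a,h)` about a site) and the cuboctahedral one (`fcc(a,h)` about a site) — cost `κ₁(δ,θ) > 0` each:
  `N·e + κ₁ · #{i : ¬Good_hcp(6/5,θ,i) ∧ ¬Good_fcc(6/5,θ,i)} ≤ 𝓔(x)`.  The LJ energy-to-coordination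
  inequality in counting form (vacuum-adjacent, over/under-coordinated, icosahedral, amorphous and
  `θ`-strained shells all pay); no pointwise cell bound is asserted (barrier `TetrahedralFrustration`).
* `stub_barlowCharts` (GEOMETRY, potential-free; the separated counting form, cf. the refuted
  stmt-3506 and its repair `HcpChartGluing`) — for `δ`-separated finite `x`, every particle that is NOT
  `θ`-matched at radius 4 to ANY Barlow stacking `Barlow(a,h,s)` lies within a bounded distance of a
  particle with a `θ'`-bad first shell, whence by `δ`-separation
  `#{i : ∀ s Hägg, ¬Good_{Barlow(a,h,s)}(4,θ,i)} ≤ M · #{i : ¬Good_hcp(6/5,θ',i) ∧ ¬Good_fcc(6/5,θ',i)}`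
  with `θ' = θ'(a,h,δ,θ) > 0`, `M = M(a,h,δ,θ) ∈ ℕ` — local rigidity: `θ'`-close-packed 12-shells on a ball
  glue, shell by shell with linear tolerance loss, into one Barlow chart of radius 4 (a packing all of
  whose shells are cuboctahedra / anticuboctahedra is a Barlow stacking, made quantitative).
* `stub_stackingTier` (ENERGY, stacking selection) — particles that ARE `θ`-matched at radius 4 to some
  Barlow stacking but not to hcp (coherent close-packed material within ~5 layers of a non-`h` layer:
  fcc, dhcp, twins, isolated faults) cost `κ₂(δ,θ) > 0` each:
  `N·e + κ₂ · #{i : (∃ s Hägg, Good_{Barlow(a,h,s)}(4,θ,i)) ∧ ¬Good_hcp(4,θ,i)} ≤ 𝓔(x)` — strict stacking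
  selection at the level of fault energies (Hägg domination of the `r⁻⁶` tail, items 0737 / 0670; the
  fcc–hcp gap `7.5e-5` per particle), conditional on the same floor.

GLUE (`composition`, sorry-free; pure counting + arithmetic): by excluded middle
`{¬Good_hcp(4,θ)} ⊆ {∀ s, ¬Good_{Barlow(s)}(4,θ)} ∪ {(∃ s, Good_{Barlow(s)}(4,θ)) ∧ ¬Good_hcp(4,θ)}`
(`card_subtype_le_add`), the first class is charged to bad shells by `stub_barlowCharts (θ ↦ θ', M)`,
and with `κ₁ = κ₁(δ,θ')`, `κ₂ = κ₂(δ,θ)` the choice `κ := min κ₁ κ₂ / (2(M+1))` gives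
`κ·#Bad ≤ κM·#BadShell(θ') + κ·#StackBad ≤ ½κ₁·#BadShell(θ') + ½κ₂·#StackBad ≤ 𝓔(x) − N·e`.
Both energetic stubs are RESTRICTIONS of the crux to a defect sub-population (crux at tolerance `θ`
implies each, by radius/tolerance monotonicity of `Good`), so neither is stronger than the crux and
neither gives it alone; `stub_barlowCharts` is independent of the potential.  `HcpDefectCoercivity_of :
HcpDefectCoercivity` concludes the crux BY NAME with no hypotheses (the three stubs discharged inside;
`sorry` lives only in `stub_*`), through `hcpDefectCoercivity_iff : HcpDefectCoercivity ↔ <body> := Iff.rfl`.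

Disproof used: none exists for this crux (`ledger crux ls stmt-AtomisticToContinuum-14476`: no workfiles
before this one; no `Theorems/HcpDefectCoercivity/Negative/`; no Disproof.lean), 2026-08-17.  Negatives
index (`ledger negatives --problem AtomisticToContinuum`, 20 statements): the only nearby entry is
stmt-3506 `OneGrainWindow.OneGrainGluing` (chart gluing WITHOUT separation, witness: particles piled on
one site) — `stub_barlowCharts` carries the `δ`-separation hypothesis and counts particles of a finite
injective-by-separation configuration, exactly the repair adopted by the route's `HcpChartGluing`.

Conventions: stub signatures are ONE LINE, FULLY QUALIFIED, over existing declarations only (the matching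
predicate is a `let`, as in the crux); the crux prefix (box, floor, `δ`, `θ`, separation) is copied
character for character from the route decl.
-/

namespace Summit.AtomisticToContinuum.Crystallization.Cruxes.HcpDefectCoercivity.Birth

open Summit.AtomisticToContinuum.Crystallization.Theses.HcpDefectCounting

/-! ## Registered stubs (sorries live ONLY here) -/

/-- **STUB 1 — first-shell (close-packing) tier, ENERGY; the hardest stub.**  Under the bulk floor at
`hcp(a,h)`, for all `δ, θ > 0` there is `κ > 0` such that every `δ`-separated finite configuration pays
`κ` for each particle whose radius-`6/5` neighbourhood is two-way `θ`-matched NEITHER to the hcp first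
shell (anticuboctahedron, template `(hcp a h).points`) NOR to the fcc first shell (cuboctahedron,
template `(fcc a h).points`): `N·e(hcp a h) + κ·#BadShell(θ) ≤ 𝓔_LJ(x)`.  Implied by the crux at the
same `θ` (`BadShell(θ) ⊆ Bad_hcp(6/5,θ) ⊆ Bad_hcp(4,θ)`).  Why plausibly true: every competing local
order (icosahedral / polytetrahedral, bcc-like, amorphous, under/over-coordinated, surface) has LJ energy
per particle strictly above `e(hcp) ≈ −0.7176` in the bulk, and strained close-packed shells pay
`O(strain²)`; the summed (not pointwise) form tolerates locally favourable icosahedral centres.  Why it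
might fail: no energy → twelve-coordination inequality is known in 3-D without a three-body term
(FlatleyTheil2015); a polytetrahedral phase with excess `o(#BadShell)`; `κ(θ) → 0` as `θ → 0` is allowed
but `κ` must not depend on `N`.  Size: open problem (Theil2006 is the `d = 2` model).
Barriers: `TetrahedralFrustration`, `IcosahedralClusters` (first-shell POINTWISE bounds are false; this
is a counting bound with the full tail and the floor hypothesis). -/
theorem stub_shellTier : ∀ (a h : ℝ) (ha : a ≠ 0) (hh : h ≠ 0), 47 / 50 ≤ a → a ≤ 1 → 39 / 50 * a ≤ h → h ≤ 17 / 20 * a → (∀ (N : ℕ) (x : Fin N → EuclideanSpace ℝ (Fin 3)), Function.Injective x → (N : ℝ) * (Literature.MathematicalPhysics.StatisticalMechanics.hcpPeriodicConfiguration ha hh).energyPerParticle Literature.MathematicalPhysics.StatisticalMechanics.lennardJones ≤ Literature.MathematicalPhysics.StatisticalMechanics.interactionEnergy Literature.MathematicalPhysics.StatisticalMechanics.lennardJones x) → ∀ δ θ : ℝ, 0 < δ → 0 < θ → ∃ κ : ℝ, 0 < κ ∧ ∀ (N : ℕ) (x : Fin N → EuclideanSpace ℝ (Fin 3)), (∀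 i j : Fin N, i ≠ j → δ ≤ dist (x i) (x j)) → let GoodT : Set (EuclideanSpace ℝ (Fin 3)) → ℝ → ℝ → Fin N → Prop := fun S ρ η i => ∃ A : EuclideanSpace ℝ (Fin 3) →ₗᵢ[ℝ] EuclideanSpace ℝ (Fin 3), (∀ p ∈ S, ‖p‖ ≤ ρ → ∃ j : Fin N, dist (x j) (x i + A p) ≤ η) ∧ (∀ j : Fin N, dist (x j) (x i) ≤ ρ → ∃ p ∈ S, dist (x j) (x i + A p) ≤ η); (N : ℝ) * (Literature.MathematicalPhysics.StatisticalMechanics.hcpPeriodicConfiguration ha hh).energyPerParticle Literature.MathematicalPhysics.StatisticalMechanics.lennardJones + κ * (Nat.card {i : Fin N // ¬ GoodT (Literature.MathematicalPhysics.StatisticalMechanics.hcpPeriodicConfiguration ha hh).points (6 / 5) θ i ∧ ¬ GoodT (Literature.MathematicalPhysics.StatisticalMechanics.fccPeriodicConfiguration ha hh).points (6 / 5) θ i} : ℝ) ≤ Literature.MathematicalPhysics.StatisticalMechanics.interactionEnergy Literature.MathematicalPhysics.StatisticalMechanics.lennardJones x := by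
  sorry

/-- **STUB 2 — Barlow charts from close-packed shells, GEOMETRY (potential-free, counting form).**
For `(a,h)` in the box and `δ, θ > 0` there are `θ' > 0` and `M ∈ ℕ` such that in every `δ`-separated
finite configuration the particles NOT two-way `θ`-matched at radius 4 to any Barlow stacking
`barlowStacking a h s` (`s` a Hägg sequence; origin-based charts suffice since every site of every
Barlow stacking is the origin of a shifted one) number at most `M` times the particles with a
`θ'`-bad first shell (neither hcp- nor fcc-matched at radius `6/5`).  Mechanism: if every particle
within `4 + O(1)` of `i` has a `θ'`-close-packed shell, glue the shells outward from `i` — adjacent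
matched shells share `≥ 4` common neighbours, an isometry fixing a close-packed shell up to `θ'` is
`O(θ')`-close to a symmetry of it, the layer normal propagates (anticuboctahedra pin it, all-cuboctahedral
balls are fcc = `barlowStacking a h constHagg`), tolerance loss is linear over the `≤ 6` steps needed
for radius 4, so `i` is Barlow-matched with `θ = C θ'`; otherwise charge `i` to a bad-shell particle within
`4 + O(1)`, multiplicity `≤ M(δ)` by separation.  Why it might fail: the quantitative form of "all shells
cuboctahedral/anticuboctahedral ⇒ Barlow" must hold uniformly on the whole `(a,h)` box (at
`h = a√(2/3)` the cuboctahedral shell does not pin the layer normal — fcc regions, still Barlow); radius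
`6/5` must isolate the first shell with slack `θ'` (it does: `1.03 < 6/5 < 1.30`); finite clusters are
consistent (extreme points have bad shells once `θ' < c·a`).  Size: L (cf. `HcpChartGluing`, stmt-14478).
Barriers: `HcpNotBravais` (met: templates are point sets about a site, improper `A` allowed, all
stackings `s` quantified); negatives stmt-3506 (met: `δ`-separation). -/
theorem stub_barlowCharts : ∀ (a h : ℝ) (ha : a ≠ 0) (hh : h ≠ 0), 47 / 50 ≤ a → a ≤ 1 → 39 / 50 * a ≤ h → h ≤ 17 / 20 * a → ∀ δ θ : ℝ, 0 < δ → 0 < θ → ∃ θ' : ℝ, 0 < θ' ∧ ∃ M : ℕ, ∀ (N : ℕ) (x : Fin N → EuclideanSpace ℝ (Fin 3)), (∀ i j : Fin N, i ≠ j → δ ≤ dist (x i) (x j)) → let GoodT : Set (EuclideanSpace ℝ (Fin 3)) → ℝ → ℝ → Fin N → Prop := fun S ρ η i => ∃ A : EuclideanSpace ℝ (Fin 3) →ₗᵢ[ℝ] EuclideanSpace ℝ (Fin 3), (∀ p ∈ S, ‖p‖ ≤ ρ → ∃ j : Fin N, dist (x j) (x i + A p) ≤ η) ∧ (∀ j :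 Fin N, dist (x j) (x i) ≤ ρ → ∃ p ∈ S, dist (x j) (x i + A p) ≤ η); Nat.card {i : Fin N // ∀ s : ℤ → ℤ, Literature.MathematicalPhysics.StatisticalMechanics.IsHaggSeq s → ¬ GoodT (Literature.MathematicalPhysics.StatisticalMechanics.barlowStacking a h s) 4 θ i} ≤ M * Nat.card {i : Fin N // ¬ GoodT (Literature.MathematicalPhysics.StatisticalMechanics.hcpPeriodicConfiguration ha hh).points (6 / 5) θ' i ∧ ¬ GoodT (Literature.MathematicalPhysics.StatisticalMechanics.fccPeriodicConfiguration ha hh).points (6 / 5) θ' i} := by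
  sorry

/-- **STUB 3 — stacking tier, ENERGY (strict stacking selection in counting form).**  Under the bulk
floor at `hcp(a,h)`, for all `δ, θ > 0` there is `κ > 0` such that every `δ`-separated finite
configuration pays `κ` for each particle that IS two-way `θ`-matched at radius 4 to some Barlow stacking
`barlowStacking a h s` but is NOT `θ`-matched at radius 4 to hcp: `N·e(hcp a h) + κ·#StackBad(θ) ≤ 𝓔_LJ(x)`.
Implied by the crux at the same `θ` (`StackBad(θ) ⊆ Bad_hcp(4,θ)`).  Why plausibly true: a radius-4
Barlow environment that is not hcp contains a non-`h` layer within `~5` layers; relaxed hcp beats fcc by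
`7.5e-5` per particle and every non-hcp Barlow stacking by a positive fault energy per column and fault
(Hägg domination of the `r⁻⁶` tail, items 0737 / 0670, `|J₂| ≈ 7.3e-5` dominating `Σ_{k≥3} k|J_k|`), and
under the floor hypothesis `hcp(a,h)` is the exact bulk optimum, so coherent wrongly-stacked material
cannot be subsidised.  Why it might fail: the sign/size of the interlayer couplings is uncertified in Lean
(fault cost `≈ 6e-5` per column rests on `J₂ < 0`); a longer polytype or aperiodic stacking degenerate with
hcp to all orders would give `StackBad` particles at zero cost (then `HcpBulkFloor` itself is in danger);
elastic accommodation of twins.  Size: open-problem/L (certified lattice-sum differences + a transfer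
argument localising the fault energy to the particles that see the fault at radius 4).
Barriers: `KissingTwelveDegeneracy`, `ShortRangeStackingBlindness` (met: radius `4 > 2h` sees the
second-layer registry and the price comes from the untruncated `r⁻⁶` tail, not from contacts). -/
theorem stub_stackingTier : ∀ (a h : ℝ) (ha : a ≠ 0) (hh : h ≠ 0), 47 / 50 ≤ a → a ≤ 1 → 39 / 50 * a ≤ h → h ≤ 17 / 20 * a → (∀ (N : ℕ) (x : Fin N → EuclideanSpace ℝ (Fin 3)), Function.Injective x → (N : ℝ) * (Literature.MathematicalPhysics.StatisticalMechanics.hcpPeriodicConfiguration ha hh).energyPerParticle Literature.MathematicalPhysics.StatisticalMechanics.lennardJones ≤ Literature.MathematicalPhysics.StatisticalMechanics.interactionEnergy Literature.MathematicalPhysics.StatisticalMechanics.lennardJones x) → ∀ δ θ : ℝ, 0 < δ → 0 < θ → ∃ κ : ℝ, 0 < κ ∧ ∀ (N : ℕ) (x : Fin N → EuclideanSpace ℝ (Fin 3)), (∀ i j : Fin N, i ≠ j → δ ≤ dist (x i) (x j)) → let GoodT : Set (EuclideanSpace ℝ (Fin 3)) → ℝ → ℝ → Fin N → Prop := fun S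 ρ η i => ∃ A : EuclideanSpace ℝ (Fin 3) →ₗᵢ[ℝ] EuclideanSpace ℝ (Fin 3), (∀ p ∈ S, ‖p‖ ≤ ρ → ∃ j : Fin N, dist (x j) (x i + A p) ≤ η) ∧ (∀ j : Fin N, dist (x j) (x i) ≤ ρ → ∃ p ∈ S, dist (x j) (x i + A p) ≤ η); (N : ℝ) * (Literature.MathematicalPhysics.StatisticalMechanics.hcpPeriodicConfiguration ha hh).energyPerParticle Literature.MathematicalPhysics.StatisticalMechanics.lennardJones + κ * (Nat.card {i : Fin N // (∃ s : ℤ → ℤ, Literature.MathematicalPhysics.StatisticalMechanics.IsHaggSeq s ∧ GoodT (Literature.MathematicalPhysics.StatisticalMechanics.barlowStacking a h s) 4 θ i) ∧ ¬ GoodT (Literature.MathematicalPhysics.StatisticalMechanics.hcpPeriodicConfiguration ha hh).points 4 θ i} : ℝ) ≤ Literature.MathematicalPhysics.StatisticalMechanics.interactionEnergy Literature.MathematicalPhysics.StatisticalMechanics.lennardJones x := by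
  sorry

/-! ## Glue (sorry-free) -/

/-- Counting: a class covered by two classes has at most the sum of their cardinalities. -/
theorem card_subtype_le_add {ι : Type*} [Finite ι] (P Q R : ι → Prop)
    (hcover : ∀ i, P i → Q i ∨ R i) :
    Nat.card {i // P i} ≤ Nat.card {i // Q i} + Nat.card {i // R i} := by
  classical
  haveI := Fintype.ofFinite ι
  have hP : Nat.card {i // P i} = (Finset.univ.filter P).card := Nat.subtype_card _ (by simp)
  have hQ : Nat.card {i // Q i} = (Finset.univ.filter Q).card := Nat.subtype_card _ (by simp)
  have hR : Nat.card {i // R i} = (Finset.univ.filter R).card := Nat.subtype_card _ (by simp)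
  rw [hP, hQ, hR]
  refine le_trans (Finset.card_le_card fun i hi => ?_) (Finset.card_union_le _ _)
  simp only [Finset.mem_filter, Finset.mem_union, Finset.mem_univ, true_and] at hi ⊢
  exact hcover i hi

/-- The crux `HcpDefectCoercivity` is, by definitional unfolding, the displayed statement (used to state
`composition` with the crux unfolded and to fold it back in `HcpDefectCoercivity_of`). -/
theorem hcpDefectCoercivity_iff :
    HcpDefectCoercivity ↔
      ∀ (a h : ℝ) (ha : a ≠ 0) (hh : h ≠ 0), 47 / 50 ≤ a → a ≤ 1 → 39 / 50 * a ≤ h → h ≤ 17 / 20 * a → (∀ (N : ℕ) (x : Fin N → EuclideanSpace ℝ (Fin 3)), Function.Injective x → (N : ℝ) * (Literature.MathematicalPhysics.StatisticalMechanics.hcpPeriodicConfiguration ha hh).energyPerParticle Literature.MathematicalPhysics.StatisticalMechanics.lennardJones ≤ Literature.MathematicalPhysics.StatisticalMechanics.interactionEnergy Literature.MathematicalPhysics.StatisticalMechanics.lennardJones x) → ∀ δ θ : ℝ, 0 < δ → 0 < θ → ∃ κ : ℝ, 0 < κ ∧ ∀ (N : ℕ) (x : Fin N → EuclideanSpace ℝ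 (Fin 3)), (∀ i j : Fin N, i ≠ j → δ ≤ dist (x i) (x j)) → let Good : ℝ → ℝ → Fin N → Prop := fun ρ η i => ∃ A : EuclideanSpace ℝ (Fin 3) →ₗᵢ[ℝ] EuclideanSpace ℝ (Fin 3), (∀ p ∈ (Literature.MathematicalPhysics.StatisticalMechanics.hcpPeriodicConfiguration ha hh).points, ‖p‖ ≤ ρ → ∃ j : Fin N, dist (x j) (x i + A p) ≤ η) ∧ (∀ j : Fin N, dist (x j) (x i) ≤ ρ → ∃ p ∈ (Literature.MathematicalPhysics.StatisticalMechanics.hcpPeriodicConfiguration ha hh).points, dist (x j) (x i + A p) ≤ η); (N : ℝ) * (Literature.MathematicalPhysics.StatisticalMechanics.hcpPeriodicConfiguration ha hh).energyPerParticle Literature.MathematicalPhysics.StatisticalMechanics.lennardJones + κ * (Nat.card {i : Fin N // ¬ Good 4 θ i} : ℝ) ≤ Literature.MathematicalPhysics.StatisticalMechanics.interactionEnergy Literature.MathematicalPhysics.StatisticalMechanics.lennardJones x :=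
  Iff.rfl

/-- **The composition** `<stub₁-sig> → <stub₂-sig> → <stub₃-sig> → (the crux, unfolded)`, NO sorry:
cover `Bad_hcp(4,θ) ⊆ NonBarlow(4,θ) ∪ StackBad(θ)` by excluded middle, charge `NonBarlow` to bad first
shells (`stub_barlowCharts`), price bad shells (`stub_shellTier` at `θ'`) and `StackBad`
(`stub_stackingTier` at `θ`), and take `κ = min κ₁ κ₂ / (2(M+1))`. -/
theorem composition :
    (∀ (a h : ℝ) (ha : a ≠ 0) (hh : h ≠ 0), 47 / 50 ≤ a → a ≤ 1 → 39 / 50 * a ≤ h → h ≤ 17 / 20 * a → (∀ (N : ℕ) (x : Fin N → EuclideanSpace ℝ (Fin 3)), Function.Injective x → (N : ℝ) * (Literature.MathematicalPhysics.StatisticalMechanics.hcpPeriodicConfiguration ha hh).energyPerParticle Literature.MathematicalPhysics.StatisticalMechanics.lennardJones ≤ Literature.MathematicalPhysics.StatisticalMechanics.interactionEnergy Literature.MathematicalPhysics.StatisticalMechanics.lennardJones x) → ∀ δ θ : ℝ, 0 < δ → 0 < θ → ∃ κ : ℝ, 0 < κ ∧ ∀ (N : ℕ) (x : Fin N → EuclideanSpace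 ℝ (Fin 3)), (∀ i j : Fin N, i ≠ j → δ ≤ dist (x i) (x j)) → let GoodT : Set (EuclideanSpace ℝ (Fin 3)) → ℝ → ℝ → Fin N → Prop := fun S ρ η i => ∃ A : EuclideanSpace ℝ (Fin 3) →ₗᵢ[ℝ] EuclideanSpace ℝ (Fin 3), (∀ p ∈ S, ‖p‖ ≤ ρ → ∃ j : Fin N, dist (x j) (x i + A p) ≤ η) ∧ (∀ j : Fin N, dist (x j) (x i) ≤ ρ → ∃ p ∈ S, dist (x j) (x i + A p) ≤ η); (N : ℝ) * (Literature.MathematicalPhysics.StatisticalMechanics.hcpPeriodicConfiguration ha hh).energyPerParticle Literature.MathematicalPhysics.StatisticalMechanics.lennardJones + κ * (Nat.card {i : Fin N // ¬ GoodT (Literature.MathematicalPhysics.StatisticalMechanics.hcpPeriodicConfiguration ha hh).points (6 / 5) θ i ∧ ¬ GoodT (Literature.MathematicalPhysics.StatisticalMechanics.fccPeriodicConfiguration ha hh).points (6 / 5) θ i} : ℝ) ≤ Literature.MathematicalPhysics.StatisticalMechanics.interactionEnergy Literature.MathematicalPhysics.StatisticalMechanics.lennardJones x) →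
    (∀ (a h : ℝ) (ha : a ≠ 0) (hh : h ≠ 0), 47 / 50 ≤ a → a ≤ 1 → 39 / 50 * a ≤ h → h ≤ 17 / 20 * a → ∀ δ θ : ℝ, 0 < δ → 0 < θ → ∃ θ' : ℝ, 0 < θ' ∧ ∃ M : ℕ, ∀ (N : ℕ) (x : Fin N → EuclideanSpace ℝ (Fin 3)), (∀ i j : Fin N, i ≠ j → δ ≤ dist (x i) (x j)) → let GoodT : Set (EuclideanSpace ℝ (Fin 3)) → ℝ → ℝ → Fin N → Prop := fun S ρ η i => ∃ A : EuclideanSpace ℝ (Fin 3) →ₗᵢ[ℝ] EuclideanSpace ℝ (Fin 3), (∀ p ∈ S, ‖p‖ ≤ ρ → ∃ j : Fin N, dist (x j) (x i + A p) ≤ η) ∧ (∀ j : Fin N, dist (x j) (x i) ≤ ρ → ∃ p ∈ S, dist (x j) (x i + A p) ≤ η); Nat.card {i : Fin N // ∀ s : ℤ → ℤ, Literature.MathematicalPhysics.StatisticalMechanics.IsHaggSeq s → ¬ GoodT (Literature.MathematicalPhysics.StatisticalMechanics.barlowStacking a h s) 4 θ i} ≤ M * Nat.card {i : Fin N // ¬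 GoodT (Literature.MathematicalPhysics.StatisticalMechanics.hcpPeriodicConfiguration ha hh).points (6 / 5) θ' i ∧ ¬ GoodT (Literature.MathematicalPhysics.StatisticalMechanics.fccPeriodicConfiguration ha hh).points (6 / 5) θ' i}) →
    (∀ (a h : ℝ) (ha : a ≠ 0) (hh : h ≠ 0), 47 / 50 ≤ a → a ≤ 1 → 39 / 50 * a ≤ h → h ≤ 17 / 20 * a → (∀ (N : ℕ) (x : Fin N → EuclideanSpace ℝ (Fin 3)), Function.Injective x → (N : ℝ) * (Literature.MathematicalPhysics.StatisticalMechanics.hcpPeriodicConfiguration ha hh).energyPerParticle Literature.MathematicalPhysics.StatisticalMechanics.lennardJones ≤ Literature.MathematicalPhysics.StatisticalMechanics.interactionEnergy Literature.MathematicalPhysics.StatisticalMechanics.lennardJones x) → ∀ δ θ : ℝ, 0 < δ → 0 < θ → ∃ κ : ℝ, 0 < κ ∧ ∀ (N : ℕ) (x : Fin N → EuclideanSpace ℝ (Fin 3)), (∀ i j : Fin N, i ≠ j → δ ≤ dist (x i) (x j)) → let GoodT : Set (EuclideanSpace ℝ (Fin 3)) → ℝ → ℝ → Fin N → Prop :=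 fun S ρ η i => ∃ A : EuclideanSpace ℝ (Fin 3) →ₗᵢ[ℝ] EuclideanSpace ℝ (Fin 3), (∀ p ∈ S, ‖p‖ ≤ ρ → ∃ j : Fin N, dist (x j) (x i + A p) ≤ η) ∧ (∀ j : Fin N, dist (x j) (x i) ≤ ρ → ∃ p ∈ S, dist (x j) (x i + A p) ≤ η); (N : ℝ) * (Literature.MathematicalPhysics.StatisticalMechanics.hcpPeriodicConfiguration ha hh).energyPerParticle Literature.MathematicalPhysics.StatisticalMechanics.lennardJones + κ * (Nat.card {i : Fin N // (∃ s : ℤ → ℤ, Literature.MathematicalPhysics.StatisticalMechanics.IsHaggSeq s ∧ GoodT (Literature.MathematicalPhysics.StatisticalMechanics.barlowStacking a h s) 4 θ i) ∧ ¬ GoodT (Literature.MathematicalPhysics.StatisticalMechanics.hcpPeriodicConfiguration ha hh).points 4 θ i} : ℝ) ≤ Literature.MathematicalPhysics.StatisticalMechanics.interactionEnergy Literature.MathematicalPhysics.StatisticalMechanics.lennardJones x) →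
      ∀ (a h : ℝ) (ha : a ≠ 0) (hh : h ≠ 0), 47 / 50 ≤ a → a ≤ 1 → 39 / 50 * a ≤ h → h ≤ 17 / 20 * a → (∀ (N : ℕ) (x : Fin N → EuclideanSpace ℝ (Fin 3)), Function.Injective x → (N : ℝ) * (Literature.MathematicalPhysics.StatisticalMechanics.hcpPeriodicConfiguration ha hh).energyPerParticle Literature.MathematicalPhysics.StatisticalMechanics.lennardJones ≤ Literature.MathematicalPhysics.StatisticalMechanics.interactionEnergy Literature.MathematicalPhysics.StatisticalMechanics.lennardJones x) → ∀ δ θ : ℝ, 0 < δ → 0 < θ → ∃ κ : ℝ, 0 < κ ∧ ∀ (N : ℕ) (x : Fin N → EuclideanSpace ℝ (Fin 3)), (∀ i j : Fin N, i ≠ j → δ ≤ dist (x i) (x j)) → let Good : ℝ → ℝ → Fin N → Prop := fun ρ η i => ∃ A : EuclideanSpace ℝ (Fin 3) →ₗᵢ[ℝ] EuclideanSpace ℝ (Fin 3), (∀ p ∈ (Literature.MathematicalPhysics.StatisticalMechanics.hcpPeriodicConfiguration ha hh).points, ‖p‖ ≤ ρ → ∃ j : Fin N, dist (x j) (x i +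 A p) ≤ η) ∧ (∀ j : Fin N, dist (x j) (x i) ≤ ρ → ∃ p ∈ (Literature.MathematicalPhysics.StatisticalMechanics.hcpPeriodicConfiguration ha hh).points, dist (x j) (x i + A p) ≤ η); (N : ℝ) * (Literature.MathematicalPhysics.StatisticalMechanics.hcpPeriodicConfiguration ha hh).energyPerParticle Literature.MathematicalPhysics.StatisticalMechanics.lennardJones + κ * (Nat.card {i : Fin N // ¬ Good 4 θ i} : ℝ) ≤ Literature.MathematicalPhysics.StatisticalMechanics.interactionEnergy Literature.MathematicalPhysics.StatisticalMechanics.lennardJones x := by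
  intro h1 h2 h3 a h ha hh hb1 hb2 hb3 hb4 hfloor δ θ hδ hθ
  obtain ⟨θ', hθ', M, hM⟩ := h2 a h ha hh hb1 hb2 hb3 hb4 δ θ hδ hθ
  obtain ⟨κ₁, hκ₁, hS⟩ := h1 a h ha hh hb1 hb2 hb3 hb4 hfloor δ θ' hδ hθ'
  obtain ⟨κ₂, hκ₂, hK⟩ := h3 a h ha hh hb1 hb2 hb3 hb4 hfloor δ θ hδ hθ
  refine ⟨min κ₁ κ₂ / (2 * ((M : ℝ) + 1)), by positivity, ?_⟩
  intro N x hsep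
  -- the three stub inequalities for this configuration (the `let GoodT` zeta/beta-reduced: definitional)
  have e1 : (N : ℝ) * (Literature.MathematicalPhysics.StatisticalMechanics.hcpPeriodicConfiguration ha hh).energyPerParticle Literature.MathematicalPhysics.StatisticalMechanics.lennardJones + κ₁ * (Nat.card {i : Fin N // ¬ (∃ A : EuclideanSpace ℝ (Fin 3) →ₗᵢ[ℝ] EuclideanSpace ℝ (Fin 3), (∀ p ∈ (Literature.MathematicalPhysics.StatisticalMechanics.hcpPeriodicConfiguration ha hh).points, ‖p‖ ≤ (6 / 5) → ∃ j : Fin N, dist (x j) (x i + A p) ≤ θ') ∧ (∀ j : Fin N, dist (x j) (x i) ≤ (6 / 5) → ∃ p ∈ (Literature.MathematicalPhysics.StatisticalMechanics.hcpPeriodicConfiguration ha hh).points, dist (x j) (x i + A p) ≤ θ')) ∧ ¬ (∃ A : EuclideanSpace ℝ (Fin 3) →ₗᵢ[ℝ] EuclideanSpace ℝ (Fin 3), (∀ p ∈ (Literature.MathematicalPhysics.StatisticalMechanics.fccPeriodicConfiguration ha hh).points, ‖p‖ ≤ (6 / 5) → ∃ j : Fin N, dist (x j) (x i + A p) ≤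 θ') ∧ (∀ j : Fin N, dist (x j) (x i) ≤ (6 / 5) → ∃ p ∈ (Literature.MathematicalPhysics.StatisticalMechanics.fccPeriodicConfiguration ha hh).points, dist (x j) (x i + A p) ≤ θ'))} : ℝ) ≤ Literature.MathematicalPhysics.StatisticalMechanics.interactionEnergy Literature.MathematicalPhysics.StatisticalMechanics.lennardJones x :=
    hS N x hsep
  have e2 : Nat.card {i : Fin N // ∀ s : ℤ → ℤ, Literature.MathematicalPhysics.StatisticalMechanics.IsHaggSeq s → ¬ (∃ A : EuclideanSpace ℝ (Fin 3) →ₗᵢ[ℝ] EuclideanSpace ℝ (Fin 3), (∀ p ∈ (Literature.MathematicalPhysics.StatisticalMechanics.barlowStacking a h s), ‖p‖ ≤ 4 → ∃ j : Fin N, dist (x j) (x i + A p) ≤ θ) ∧ (∀ j : Fin N, dist (x j) (x i) ≤ 4 → ∃ p ∈ (Literature.MathematicalPhysics.StatisticalMechanics.barlowStacking a h s), dist (x j) (x i + A p) ≤ θ))} ≤ M * Nat.card {i : Fin N // ¬ (∃ A : EuclideanSpace ℝ (Fin 3) →ₗᵢ[ℝ] EuclideanSpace ℝ (Fin 3), (∀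 p ∈ (Literature.MathematicalPhysics.StatisticalMechanics.hcpPeriodicConfiguration ha hh).points, ‖p‖ ≤ (6 / 5) → ∃ j : Fin N, dist (x j) (x i + A p) ≤ θ') ∧ (∀ j : Fin N, dist (x j) (x i) ≤ (6 / 5) → ∃ p ∈ (Literature.MathematicalPhysics.StatisticalMechanics.hcpPeriodicConfiguration ha hh).points, dist (x j) (x i + A p) ≤ θ')) ∧ ¬ (∃ A : EuclideanSpace ℝ (Fin 3) →ₗᵢ[ℝ] EuclideanSpace ℝ (Fin 3), (∀ p ∈ (Literature.MathematicalPhysics.StatisticalMechanics.fccPeriodicConfiguration ha hh).points, ‖p‖ ≤ (6 / 5) → ∃ j : Fin N, dist (x j) (x i + A p) ≤ θ') ∧ (∀ j : Fin N, dist (x j) (x i) ≤ (6 / 5) → ∃ p ∈ (Literature.MathematicalPhysics.StatisticalMechanics.fccPeriodicConfiguration ha hh).points, dist (x j) (x i + A p) ≤ θ'))} :=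
    hM N x hsep
  have e3 : (N : ℝ) * (Literature.MathematicalPhysics.StatisticalMechanics.hcpPeriodicConfiguration ha hh).energyPerParticle Literature.MathematicalPhysics.StatisticalMechanics.lennardJones + κ₂ * (Nat.card {i : Fin N // (∃ s : ℤ → ℤ, Literature.MathematicalPhysics.StatisticalMechanics.IsHaggSeq s ∧ (∃ A : EuclideanSpace ℝ (Fin 3) →ₗᵢ[ℝ] EuclideanSpace ℝ (Fin 3), (∀ p ∈ (Literature.MathematicalPhysics.StatisticalMechanics.barlowStacking a h s), ‖p‖ ≤ 4 → ∃ j : Fin N, dist (x j) (x i + A p) ≤ θ) ∧ (∀ j : Fin N, dist (x j) (x i) ≤ 4 → ∃ p ∈ (Literature.MathematicalPhysics.StatisticalMechanics.barlowStacking a h s), dist (x j) (x i + A p) ≤ θ))) ∧ ¬ (∃ A : EuclideanSpace ℝ (Fin 3) →ₗᵢ[ℝ] EuclideanSpace ℝ (Fin 3), (∀ p ∈ (Literature.MathematicalPhysics.StatisticalMechanics.hcpPeriodicConfiguration ha hh).points, ‖p‖ ≤ 4 → ∃ j : Fin N, dist (x j) (x i + A p) ≤ θ) ∧ (∀ j :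 Fin N, dist (x j) (x i) ≤ 4 → ∃ p ∈ (Literature.MathematicalPhysics.StatisticalMechanics.hcpPeriodicConfiguration ha hh).points, dist (x j) (x i + A p) ≤ θ))} : ℝ) ≤ Literature.MathematicalPhysics.StatisticalMechanics.interactionEnergy Literature.MathematicalPhysics.StatisticalMechanics.lennardJones x :=
    hK N x hsep
  show (N : ℝ) * (Literature.MathematicalPhysics.StatisticalMechanics.hcpPeriodicConfiguration ha hh).energyPerParticle Literature.MathematicalPhysics.StatisticalMechanics.lennardJones + min κ₁ κ₂ / (2 * ((M : ℝ) + 1)) * (Nat.card {i : Fin N // ¬ (∃ A : EuclideanSpace ℝ (Fin 3) →ₗᵢ[ℝ] EuclideanSpace ℝ (Fin 3), (∀ p ∈ (Literature.MathematicalPhysics.StatisticalMechanics.hcpPeriodicConfiguration ha hh).points, ‖p‖ ≤ 4 → ∃ j : Fin N, dist (x j) (x i + A p) ≤ θ) ∧ (∀ j : Fin N, dist (x j) (x i) ≤ 4 → ∃ p ∈ (Literature.MathematicalPhysics.StatisticalMechanics.hcpPeriodicConfiguration ha hh).points, dist (x j) (x i + A p) ≤ θ))} : ℝ) ≤ Literature.MathematicalPhysics.StatisticalMechanics.interactionEnergy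 Literature.MathematicalPhysics.StatisticalMechanics.lennardJones x
  -- cover: not hcp-matched ⇒ (matched to no Barlow stacking) ∨ (matched to some Barlow stacking, not to hcp)
  have hcover : Nat.card {i : Fin N // ¬ (∃ A : EuclideanSpace ℝ (Fin 3) →ₗᵢ[ℝ] EuclideanSpace ℝ (Fin 3), (∀ p ∈ (Literature.MathematicalPhysics.StatisticalMechanics.hcpPeriodicConfiguration ha hh).points, ‖p‖ ≤ 4 → ∃ j : Fin N, dist (x j) (x i + A p) ≤ θ) ∧ (∀ j : Fin N, dist (x j) (x i) ≤ 4 → ∃ p ∈ (Literature.MathematicalPhysics.StatisticalMechanics.hcpPeriodicConfiguration ha hh).points, dist (x j) (x i + A p) ≤ θ))} ≤ Nat.card {i : Fin N // ∀ s : ℤ → ℤ, Literature.MathematicalPhysics.StatisticalMechanics.IsHaggSeq s → ¬ (∃ A : EuclideanSpace ℝ (Fin 3) →ₗᵢ[ℝ] EuclideanSpace ℝ (Fin 3), (∀ p ∈ (Literature.MathematicalPhysics.StatisticalMechanics.barlowStacking a h s), ‖p‖ ≤ 4 → ∃ j : Fin N, dist (x j) (x i + A p) ≤ θ) ∧ (∀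 j : Fin N, dist (x j) (x i) ≤ 4 → ∃ p ∈ (Literature.MathematicalPhysics.StatisticalMechanics.barlowStacking a h s), dist (x j) (x i + A p) ≤ θ))} + Nat.card {i : Fin N // (∃ s : ℤ → ℤ, Literature.MathematicalPhysics.StatisticalMechanics.IsHaggSeq s ∧ (∃ A : EuclideanSpace ℝ (Fin 3) →ₗᵢ[ℝ] EuclideanSpace ℝ (Fin 3), (∀ p ∈ (Literature.MathematicalPhysics.StatisticalMechanics.barlowStacking a h s), ‖p‖ ≤ 4 → ∃ j : Fin N, dist (x j) (x i + A p) ≤ θ) ∧ (∀ j : Fin N, dist (x j) (x i) ≤ 4 → ∃ p ∈ (Literature.MathematicalPhysics.StatisticalMechanics.barlowStacking a h s), dist (x j) (x i + A p) ≤ θ))) ∧ ¬ (∃ A : EuclideanSpace ℝ (Fin 3) →ₗᵢ[ℝ] EuclideanSpace ℝ (Fin 3), (∀ p ∈ (Literature.MathematicalPhysics.StatisticalMechanics.hcpPeriodicConfiguration ha hh).points, ‖p‖ ≤ 4 → ∃ j : Fin N, dist (x j) (x i + A p) ≤ θ) ∧ (∀ j : Fin N, dist (x j) (x i) ≤ 4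 → ∃ p ∈ (Literature.MathematicalPhysics.StatisticalMechanics.hcpPeriodicConfiguration ha hh).points, dist (x j) (x i + A p) ≤ θ))} := by
    refine card_subtype_le_add _ _ _ fun i hi => ?_
    by_cases hq : ∃ s : ℤ → ℤ, Literature.MathematicalPhysics.StatisticalMechanics.IsHaggSeq s ∧ (∃ A : EuclideanSpace ℝ (Fin 3) →ₗᵢ[ℝ] EuclideanSpace ℝ (Fin 3), (∀ p ∈ (Literature.MathematicalPhysics.StatisticalMechanics.barlowStacking a h s), ‖p‖ ≤ 4 → ∃ j : Fin N, dist (x j) (x i + A p) ≤ θ) ∧ (∀ j : Fin N, dist (x j) (x i) ≤ 4 → ∃ p ∈ (Literature.MathematicalPhysics.StatisticalMechanics.barlowStacking a h s), dist (x j) (x i + A p) ≤ θ))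
    · exact Or.inr ⟨hq, hi⟩
    · exact Or.inl fun s hs hG => hq ⟨s, hs, hG⟩
  -- arithmetic
  have cP : (Nat.card {i : Fin N // ¬ (∃ A : EuclideanSpace ℝ (Fin 3) →ₗᵢ[ℝ] EuclideanSpace ℝ (Fin 3), (∀ p ∈ (Literature.MathematicalPhysics.StatisticalMechanics.hcpPeriodicConfiguration ha hh).points, ‖p‖ ≤ 4 → ∃ j : Fin N, dist (x j) (x i + A p) ≤ θ) ∧ (∀ j : Fin N, dist (x j) (x i) ≤ 4 → ∃ p ∈ (Literature.MathematicalPhysics.StatisticalMechanics.hcpPeriodicConfiguration ha hh).points, dist (x j) (x i + A p) ≤ θ))} : ℝ) ≤ (Nat.card {i : Fin N // ∀ s : ℤ → ℤ, Literature.MathematicalPhysics.StatisticalMechanics.IsHaggSeq s → ¬ (∃ A : EuclideanSpace ℝ (Fin 3) →ₗᵢ[ℝ] EuclideanSpace ℝ (Fin 3), (∀ p ∈ (Literature.MathematicalPhysics.StatisticalMechanics.barlowStacking a h s), ‖p‖ ≤ 4 → ∃ j : Fin N, dist (x j) (x i + A p) ≤ θ) ∧ (∀ j : Fin N, dist (x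 j) (x i) ≤ 4 → ∃ p ∈ (Literature.MathematicalPhysics.StatisticalMechanics.barlowStacking a h s), dist (x j) (x i + A p) ≤ θ))} : ℝ) + (Nat.card {i : Fin N // (∃ s : ℤ → ℤ, Literature.MathematicalPhysics.StatisticalMechanics.IsHaggSeq s ∧ (∃ A : EuclideanSpace ℝ (Fin 3) →ₗᵢ[ℝ] EuclideanSpace ℝ (Fin 3), (∀ p ∈ (Literature.MathematicalPhysics.StatisticalMechanics.barlowStacking a h s), ‖p‖ ≤ 4 → ∃ j : Fin N, dist (x j) (x i + A p) ≤ θ) ∧ (∀ j : Fin N, dist (x j) (x i) ≤ 4 → ∃ p ∈ (Literature.MathematicalPhysics.StatisticalMechanics.barlowStacking a h s), dist (x j) (x i + A p) ≤ θ))) ∧ ¬ (∃ A : EuclideanSpace ℝ (Fin 3) →ₗᵢ[ℝ] EuclideanSpace ℝ (Fin 3), (∀ p ∈ (Literature.MathematicalPhysics.StatisticalMechanics.hcpPeriodicConfiguration ha hh).points, ‖p‖ ≤ 4 → ∃ j : Fin N, dist (x j) (x i + A p) ≤ θ) ∧ (∀ j : Fin N, dist (x j) (x i) ≤ 4 → ∃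 p ∈ (Literature.MathematicalPhysics.StatisticalMechanics.hcpPeriodicConfiguration ha hh).points, dist (x j) (x i + A p) ≤ θ))} : ℝ) := by
    exact_mod_cast hcover
  have cQ : (Nat.card {i : Fin N // ∀ s : ℤ → ℤ, Literature.MathematicalPhysics.StatisticalMechanics.IsHaggSeq s → ¬ (∃ A : EuclideanSpace ℝ (Fin 3) →ₗᵢ[ℝ] EuclideanSpace ℝ (Fin 3), (∀ p ∈ (Literature.MathematicalPhysics.StatisticalMechanics.barlowStacking a h s), ‖p‖ ≤ 4 → ∃ j : Fin N, dist (x j) (x i + A p) ≤ θ) ∧ (∀ j : Fin N, dist (x j) (x i) ≤ 4 → ∃ p ∈ (Literature.MathematicalPhysics.StatisticalMechanics.barlowStacking a h s), dist (x j) (x i + A p) ≤ θ))} : ℝ) ≤ (M : ℝ) * (Nat.card {i : Fin N // ¬ (∃ A : EuclideanSpace ℝ (Fin 3) →ₗᵢ[ℝ] EuclideanSpace ℝ (Fin 3), (∀ p ∈ (Literature.MathematicalPhysics.StatisticalMechanics.hcpPeriodicConfiguration ha hh).points, ‖p‖ ≤ (6 / 5) → ∃ j : Fin N, dist (x j) (x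 i + A p) ≤ θ') ∧ (∀ j : Fin N, dist (x j) (x i) ≤ (6 / 5) → ∃ p ∈ (Literature.MathematicalPhysics.StatisticalMechanics.hcpPeriodicConfiguration ha hh).points, dist (x j) (x i + A p) ≤ θ')) ∧ ¬ (∃ A : EuclideanSpace ℝ (Fin 3) →ₗᵢ[ℝ] EuclideanSpace ℝ (Fin 3), (∀ p ∈ (Literature.MathematicalPhysics.StatisticalMechanics.fccPeriodicConfiguration ha hh).points, ‖p‖ ≤ (6 / 5) → ∃ j : Fin N, dist (x j) (x i + A p) ≤ θ') ∧ (∀ j : Fin N, dist (x j) (x i) ≤ (6 / 5) → ∃ p ∈ (Literature.MathematicalPhysics.StatisticalMechanics.fccPeriodicConfiguration ha hh).points, dist (x j) (x i + A p) ≤ θ'))} : ℝ) := by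
    exact_mod_cast e2
  have hM0 : (0 : ℝ) ≤ (M : ℝ) := Nat.cast_nonneg M
  have hBS0 : (0 : ℝ) ≤ (Nat.card {i : Fin N // ¬ (∃ A : EuclideanSpace ℝ (Fin 3) →ₗᵢ[ℝ] EuclideanSpace ℝ (Fin 3), (∀ p ∈ (Literature.MathematicalPhysics.StatisticalMechanics.hcpPeriodicConfiguration ha hh).points, ‖p‖ ≤ (6 / 5) → ∃ j : Fin N, dist (x j) (x i + A p) ≤ θ') ∧ (∀ j : Fin N, dist (x j) (x i) ≤ (6 / 5) → ∃ p ∈ (Literature.MathematicalPhysics.StatisticalMechanics.hcpPeriodicConfiguration ha hh).points, dist (x j) (x i + A p) ≤ θ')) ∧ ¬ (∃ A : EuclideanSpace ℝ (Fin 3) →ₗᵢ[ℝ] EuclideanSpace ℝ (Fin 3), (∀ p ∈ (Literature.MathematicalPhysics.StatisticalMechanics.fccPeriodicConfiguration ha hh).points, ‖p‖ ≤ (6 / 5) → ∃ j : Fin N, dist (x j) (x i + A p) ≤ θ') ∧ (∀ j : Fin N, dist (x j) (x i) ≤ (6 / 5) → ∃ p ∈ (Literature.MathematicalPhysics.StatisticalMechanics.fccPeriodicConfiguration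 ha hh).points, dist (x j) (x i + A p) ≤ θ'))} : ℝ) := Nat.cast_nonneg _
  have hR0 : (0 : ℝ) ≤ (Nat.card {i : Fin N // (∃ s : ℤ → ℤ, Literature.MathematicalPhysics.StatisticalMechanics.IsHaggSeq s ∧ (∃ A : EuclideanSpace ℝ (Fin 3) →ₗᵢ[ℝ] EuclideanSpace ℝ (Fin 3), (∀ p ∈ (Literature.MathematicalPhysics.StatisticalMechanics.barlowStacking a h s), ‖p‖ ≤ 4 → ∃ j : Fin N, dist (x j) (x i + A p) ≤ θ) ∧ (∀ j : Fin N, dist (x j) (x i) ≤ 4 → ∃ p ∈ (Literature.MathematicalPhysics.StatisticalMechanics.barlowStacking a h s), dist (x j) (x i + A p) ≤ θ))) ∧ ¬ (∃ A : EuclideanSpace ℝ (Fin 3) →ₗᵢ[ℝ] EuclideanSpace ℝ (Fin 3), (∀ p ∈ (Literature.MathematicalPhysics.StatisticalMechanics.hcpPeriodicConfiguration ha hh).points, ‖p‖ ≤ 4 → ∃ j : Fin N, dist (x j) (x i + A p) ≤ θ) ∧ (∀ j : Fin N, dist (x j) (x i) ≤ 4 → ∃ p ∈ (Literature.MathematicalPhysics.StatisticalMechanics.hcpPeriodicConfiguration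 ha hh).points, dist (x j) (x i + A p) ≤ θ))} : ℝ) := Nat.cast_nonneg _
  have hκ0 : (0 : ℝ) < min κ₁ κ₂ / (2 * ((M : ℝ) + 1)) := by positivity
  have hkey : min κ₁ κ₂ / (2 * ((M : ℝ) + 1)) * (2 * ((M : ℝ) + 1)) = min κ₁ κ₂ :=
    div_mul_cancel₀ _ (by positivity)
  set κ : ℝ := min κ₁ κ₂ / (2 * ((M : ℝ) + 1)) with hκ
  have hmin1 : min κ₁ κ₂ ≤ κ₁ := min_le_left _ _
  have hmin2 : min κ₁ κ₂ ≤ κ₂ := min_le_right _ _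
  have hκM : (0 : ℝ) ≤ κ * (M : ℝ) := mul_nonneg hκ0.le hM0
  have hk1 : 2 * (κ * (M : ℝ)) ≤ κ₁ := by linarith
  have hk2 : 2 * κ ≤ κ₂ := by linarith
  have s1 : κ * (Nat.card {i : Fin N // ¬ (∃ A : EuclideanSpace ℝ (Fin 3) →ₗᵢ[ℝ] EuclideanSpace ℝ (Fin 3), (∀ p ∈ (Literature.MathematicalPhysics.StatisticalMechanics.hcpPeriodicConfiguration ha hh).points, ‖p‖ ≤ 4 → ∃ j : Fin N, dist (x j) (x i + A p) ≤ θ) ∧ (∀ j : Fin N, dist (x j) (x i) ≤ 4 → ∃ p ∈ (Literature.MathematicalPhysics.StatisticalMechanics.hcpPeriodicConfiguration ha hh).points, dist (x j) (x i + A p) ≤ θ))} : ℝ) ≤ κ * ((Nat.card {i : Fin N // ∀ s : ℤ → ℤ, Literature.MathematicalPhysics.StatisticalMechanics.IsHaggSeq s → ¬ (∃ A : EuclideanSpace ℝ (Fin 3) →ₗᵢ[ℝ] EuclideanSpace ℝ (Fin 3), (∀ p ∈ (Literature.MathematicalPhysics.StatisticalMechanics.barlowStacking a h s), ‖p‖ ≤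 4 → ∃ j : Fin N, dist (x j) (x i + A p) ≤ θ) ∧ (∀ j : Fin N, dist (x j) (x i) ≤ 4 → ∃ p ∈ (Literature.MathematicalPhysics.StatisticalMechanics.barlowStacking a h s), dist (x j) (x i + A p) ≤ θ))} : ℝ) + (Nat.card {i : Fin N // (∃ s : ℤ → ℤ, Literature.MathematicalPhysics.StatisticalMechanics.IsHaggSeq s ∧ (∃ A : EuclideanSpace ℝ (Fin 3) →ₗᵢ[ℝ] EuclideanSpace ℝ (Fin 3), (∀ p ∈ (Literature.MathematicalPhysics.StatisticalMechanics.barlowStacking a h s), ‖p‖ ≤ 4 → ∃ j : Fin N, dist (x j) (x i + A p) ≤ θ) ∧ (∀ j : Fin N, dist (x j) (x i) ≤ 4 → ∃ p ∈ (Literature.MathematicalPhysics.StatisticalMechanics.barlowStacking a h s), dist (x j) (x i + A p) ≤ θ))) ∧ ¬ (∃ A : EuclideanSpace ℝ (Fin 3) →ₗᵢ[ℝ] EuclideanSpace ℝ (Fin 3), (∀ p ∈ (Literature.MathematicalPhysics.StatisticalMechanics.hcpPeriodicConfiguration ha hh).points, ‖p‖ ≤ 4 → ∃ j : Fin N, dist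 (x j) (x i + A p) ≤ θ) ∧ (∀ j : Fin N, dist (x j) (x i) ≤ 4 → ∃ p ∈ (Literature.MathematicalPhysics.StatisticalMechanics.hcpPeriodicConfiguration ha hh).points, dist (x j) (x i + A p) ≤ θ))} : ℝ)) :=
    mul_le_mul_of_nonneg_left cP hκ0.le
  have s2 : κ * (Nat.card {i : Fin N // ∀ s : ℤ → ℤ, Literature.MathematicalPhysics.StatisticalMechanics.IsHaggSeq s → ¬ (∃ A : EuclideanSpace ℝ (Fin 3) →ₗᵢ[ℝ] EuclideanSpace ℝ (Fin 3), (∀ p ∈ (Literature.MathematicalPhysics.StatisticalMechanics.barlowStacking a h s), ‖p‖ ≤ 4 → ∃ j : Fin N, dist (x j) (x i + A p) ≤ θ) ∧ (∀ j : Fin N, dist (x j) (x i) ≤ 4 → ∃ p ∈ (Literature.MathematicalPhysics.StatisticalMechanics.barlowStacking a h s), dist (x j) (x i + A p) ≤ θ))} : ℝ) ≤ κ * ((M : ℝ) * (Nat.card {i : Fin N // ¬ (∃ A : EuclideanSpace ℝ (Fin 3) →ₗᵢ[ℝ] EuclideanSpace ℝ (Fin 3), (∀ p ∈ (Literature.MathematicalPhysics.StatisticalMechanics.hcpPeriodicConfiguration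 ha hh).points, ‖p‖ ≤ (6 / 5) → ∃ j : Fin N, dist (x j) (x i + A p) ≤ θ') ∧ (∀ j : Fin N, dist (x j) (x i) ≤ (6 / 5) → ∃ p ∈ (Literature.MathematicalPhysics.StatisticalMechanics.hcpPeriodicConfiguration ha hh).points, dist (x j) (x i + A p) ≤ θ')) ∧ ¬ (∃ A : EuclideanSpace ℝ (Fin 3) →ₗᵢ[ℝ] EuclideanSpace ℝ (Fin 3), (∀ p ∈ (Literature.MathematicalPhysics.StatisticalMechanics.fccPeriodicConfiguration ha hh).points, ‖p‖ ≤ (6 / 5) → ∃ j : Fin N, dist (x j) (x i + A p) ≤ θ') ∧ (∀ j : Fin N, dist (x j) (x i) ≤ (6 / 5) → ∃ p ∈ (Literature.MathematicalPhysics.StatisticalMechanics.fccPeriodicConfiguration ha hh).points, dist (x j) (x i + A p) ≤ θ'))} : ℝ)) :=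
    mul_le_mul_of_nonneg_left cQ hκ0.le
  have s3 : 2 * (κ * (M : ℝ)) * (Nat.card {i : Fin N // ¬ (∃ A : EuclideanSpace ℝ (Fin 3) →ₗᵢ[ℝ] EuclideanSpace ℝ (Fin 3), (∀ p ∈ (Literature.MathematicalPhysics.StatisticalMechanics.hcpPeriodicConfiguration ha hh).points, ‖p‖ ≤ (6 / 5) → ∃ j : Fin N, dist (x j) (x i + A p) ≤ θ') ∧ (∀ j : Fin N, dist (x j) (x i) ≤ (6 / 5) → ∃ p ∈ (Literature.MathematicalPhysics.StatisticalMechanics.hcpPeriodicConfiguration ha hh).points, dist (x j) (x i + A p) ≤ θ')) ∧ ¬ (∃ A : EuclideanSpace ℝ (Fin 3) →ₗᵢ[ℝ] EuclideanSpace ℝ (Fin 3), (∀ p ∈ (Literature.MathematicalPhysics.StatisticalMechanics.fccPeriodicConfiguration ha hh).points, ‖p‖ ≤ (6 / 5) → ∃ j : Fin N, dist (x j) (x i + A p) ≤ θ') ∧ (∀ j : Fin N, dist (x j) (x i) ≤ (6 / 5) → ∃ p ∈ (Literature.MathematicalPhysics.StatisticalMechanics.fccPeriodicConfiguration ha hh).points,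 dist (x j) (x i + A p) ≤ θ'))} : ℝ) ≤ κ₁ * (Nat.card {i : Fin N // ¬ (∃ A : EuclideanSpace ℝ (Fin 3) →ₗᵢ[ℝ] EuclideanSpace ℝ (Fin 3), (∀ p ∈ (Literature.MathematicalPhysics.StatisticalMechanics.hcpPeriodicConfiguration ha hh).points, ‖p‖ ≤ (6 / 5) → ∃ j : Fin N, dist (x j) (x i + A p) ≤ θ') ∧ (∀ j : Fin N, dist (x j) (x i) ≤ (6 / 5) → ∃ p ∈ (Literature.MathematicalPhysics.StatisticalMechanics.hcpPeriodicConfiguration ha hh).points, dist (x j) (x i + A p) ≤ θ')) ∧ ¬ (∃ A : EuclideanSpace ℝ (Fin 3) →ₗᵢ[ℝ] EuclideanSpace ℝ (Fin 3), (∀ p ∈ (Literature.MathematicalPhysics.StatisticalMechanics.fccPeriodicConfiguration ha hh).points, ‖p‖ ≤ (6 / 5) → ∃ j : Fin N, dist (x j) (x i + A p) ≤ θ') ∧ (∀ j : Fin N, dist (x j) (x i) ≤ (6 / 5) → ∃ p ∈ (Literature.MathematicalPhysics.StatisticalMechanics.fccPeriodicConfiguration ha hh).points, dist (x j) (x i +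 A p) ≤ θ'))} : ℝ) :=
    mul_le_mul_of_nonneg_right hk1 hBS0
  have s4 : 2 * κ * (Nat.card {i : Fin N // (∃ s : ℤ → ℤ, Literature.MathematicalPhysics.StatisticalMechanics.IsHaggSeq s ∧ (∃ A : EuclideanSpace ℝ (Fin 3) →ₗᵢ[ℝ] EuclideanSpace ℝ (Fin 3), (∀ p ∈ (Literature.MathematicalPhysics.StatisticalMechanics.barlowStacking a h s), ‖p‖ ≤ 4 → ∃ j : Fin N, dist (x j) (x i + A p) ≤ θ) ∧ (∀ j : Fin N, dist (x j) (x i) ≤ 4 → ∃ p ∈ (Literature.MathematicalPhysics.StatisticalMechanics.barlowStacking a h s), dist (x j) (x i + A p) ≤ θ))) ∧ ¬ (∃ A : EuclideanSpace ℝ (Fin 3) →ₗᵢ[ℝ] EuclideanSpace ℝ (Fin 3), (∀ p ∈ (Literature.MathematicalPhysics.StatisticalMechanics.hcpPeriodicConfiguration ha hh).points, ‖p‖ ≤ 4 → ∃ j : Fin N, dist (x j) (x i + A p) ≤ θ) ∧ (∀ j : Fin N, dist (x j) (x i) ≤ 4 → ∃ p ∈ (Literature.MathematicalPhysics.StatisticalMechanics.hcpPeriodicConfiguration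 ha hh).points, dist (x j) (x i + A p) ≤ θ))} : ℝ) ≤ κ₂ * (Nat.card {i : Fin N // (∃ s : ℤ → ℤ, Literature.MathematicalPhysics.StatisticalMechanics.IsHaggSeq s ∧ (∃ A : EuclideanSpace ℝ (Fin 3) →ₗᵢ[ℝ] EuclideanSpace ℝ (Fin 3), (∀ p ∈ (Literature.MathematicalPhysics.StatisticalMechanics.barlowStacking a h s), ‖p‖ ≤ 4 → ∃ j : Fin N, dist (x j) (x i + A p) ≤ θ) ∧ (∀ j : Fin N, dist (x j) (x i) ≤ 4 → ∃ p ∈ (Literature.MathematicalPhysics.StatisticalMechanics.barlowStacking a h s), dist (x j) (x i + A p) ≤ θ))) ∧ ¬ (∃ A : EuclideanSpace ℝ (Fin 3) →ₗᵢ[ℝ] EuclideanSpace ℝ (Fin 3), (∀ p ∈ (Literature.MathematicalPhysics.StatisticalMechanics.hcpPeriodicConfiguration ha hh).points, ‖p‖ ≤ 4 → ∃ j : Fin N, dist (x j) (x i + A p) ≤ θ) ∧ (∀ j : Fin N, dist (x j) (x i) ≤ 4 → ∃ p ∈ (Literature.MathematicalPhysics.StatisticalMechanics.hcpPeriodicConfiguration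 ha hh).points, dist (x j) (x i + A p) ≤ θ))} : ℝ) :=
    mul_le_mul_of_nonneg_right hk2 hR0
  linarith

/-- **The crux from the line, concluded BY NAME** (type literally the route decl
`HcpDefectCounting.HcpDefectCoercivity`; no hypotheses — the three declared stubs are discharged inside
the proof, so `sorry` lives only in `stub_*` and this theorem reaches `sorryAx` only through them). -/
theorem HcpDefectCoercivity_of : HcpDefectCoercivity :=
  hcpDefectCoercivity_iff.2 (composition stub_shellTier stub_barlowCharts stub_stackingTier)

end Summit.AtomisticToContinuum.Crystallization.Cruxes.HcpDefectCoercivity.Birth
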